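import Summits.Langlands.Langlands.Theses.QuarterDeficit1951
import Literature.NumberTheory.GaloisRepresentations.GaloisRepUnramifiedProofs
import Literature.NumberTheory.GaloisRepresentations.TateUnramifiedLiftingHolds
import Literature.NumberTheory.GaloisRepresentations.DirichletCharacterOfGaloisCharacter
import Literature.FieldTheory.AlgClosed.PadicAlgClEquivComplex
import Literature.NumberTheory.Automorphic.BCDTTheoremBWildAtThreeDet
import Literature.NumberTheory.GaloisRepresentations.FrobeniusOnTameInertiaImage
import Literature.NumberTheory.GaloisRepresentations.DecompositionGroupOfCompletion
import Literature.NumberTheory.GaloisRepresentations.TateLevelOneLocalGenerators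
import Literature.NumberTheory.GaloisRepresentations.RamificationFiltrationProofs
import Literature.NumberTheory.GaloisRepresentations.IntegralGaloisActionProofs
import Literature.NumberTheory.GaloisRepresentations.FramedRepTwistEulerFactorProofs
import Literature.NumberTheory.Automorphic.AdicCompletionLocalField

/-!
# Route `QuarterDeficit1951` (Langlands) — crux `IcosahedralSupply` (stmt-Langlands-15899), line `Sketch`

Helper stub `dmLocal1951_decomposition_map_eq_zpowers` of `stub_dmLocal1951` (the "type 3a"
behaviour of the Doud–Moore field at `1951`): for a homomorphism `e₀ : Γ_ℚ → S₅` with open kernel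
and a prime `𝔓 ∣ 1951` whose inertia image is generated by a `5`-cycle `g`, the DECOMPOSITION image
is the same group `⟨g⟩`.  Reason: `Γ_{ℚ_1951} / I` is generated by Frobenius, which acts on the
tame inertia quotient by `u ↦ u ^ 1951 = u` (as `1951 ≡ 1 mod 5`), so `e₀(Frob)` centralises `g`,
and the centraliser of a `5`-cycle in `S₅` is `⟨g⟩` (decidable).  The local statement is the
tree's `range_eq_zpowers_of_map_absInertia_eq_zpowers` (`FrobeniusOnTameInertiaImage`); the passage
global ↔ local is the `adicCompletionPrime` dictionary (`DecompositionGroupOfCompletion`), and the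
other primes above `1951` are reached by conjugation.
-/

set_option linter.dupNamespace false

noncomputable section

open scoped NumberField MatrixGroups Pointwise
open Field IsDedekindDomain Polynomial
open Literature.NumberTheory.GaloisRepresentations Literature.NumberTheory.PAdicHodge

namespace Summit.Langlands.Langlands.Theorems.QuarterDeficit1951

/-- The centraliser of a `5`-cycle in `S₅` is the cyclic group it generates (kernel-decidable
enumeration over `S₅ × S₅`). [folklore] -/
theorem perm_five_comm_of_pow_five (g x : Equiv.Perm (Fin 5)) (hg : g ^ 5 = 1) (hg1 : g ≠ 1)
    (hx : x * g = g * x) : x = 1 ∨ x = g ∨ x = g ^ 2 ∨ x = g ^ 3 ∨ x = g ^ 4 := by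
  revert g x
  set_option maxRecDepth 100000 in
  decide

/-- Centraliser of an element of order `5` of `S₅`, in subgroup form: everything commuting with
`g` lies in `⟨g⟩`. [folklore] -/
theorem mem_zpowers_of_comm_of_orderOf_eq_five {g : Equiv.Perm (Fin 5)} (hg : orderOf g = 5)
    (x : Equiv.Perm (Fin 5)) (hx : x * g = g * x) : x ∈ Subgroup.zpowers g := by
  have hg5 : g ^ 5 = 1 := orderOf_dvd_iff_pow_eq_one.mp (by rw [hg])
  have hg1 : g ≠ 1 := by
    rintro rfl
    rw [orderOf_one] at hg
    exact absurd hg (by norm_num)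
  rcases perm_five_comm_of_pow_five g x hg5 hg1 hx with h | h | h | h | h <;> rw [h]
  · exact one_mem _
  · exact Subgroup.mem_zpowers g
  all_goals exact Subgroup.npow_mem_zpowers g _

/-- Images commute with conjugation: `e₀ (τ H τ⁻¹) = e₀(τ) · e₀(H) · e₀(τ)⁻¹`. [folklore] -/
theorem map_conj_smul {G H : Type*} [Group G] [Group H] (f : G →* H) (τ : G) (S : Subgroup G) :
    (MulAut.conj τ • S).map f = MulAut.conj (f τ) • S.map f := by
  rw [Subgroup.pointwise_smul_def, Subgroup.pointwise_smul_def, Subgroup.map_map, Subgroup.map_map]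
  congr 1
  ext x
  simp [map_mul, map_inv]

/-- Conjugating a cyclic subgroup: `h ⟨g⟩ h⁻¹ = ⟨h g h⁻¹⟩`. [folklore] -/
theorem conj_smul_zpowers {H : Type*} [Group H] (h g : H) :
    MulAut.conj h • Subgroup.zpowers g = Subgroup.zpowers (MulAut.conj h g) := by
  rw [Subgroup.pointwise_smul_def, MonoidHom.map_zpowers]
  rfl

/-- **Helper stub `dmLocal1951_decomposition_map_eq_zpowers` (type 3a at `1951`).**  For a
homomorphism `e₀ : Γ_ℚ → S₅` with open kernel and a prime `𝔓` above `1951` whose inertia image is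
`⟨g⟩` with `g` of order `5`, the decomposition image is `⟨g⟩` as well: Frobenius acts on tame
inertia through `u ↦ u^1951 = u` (`1951 ≡ 1 mod 5`) and the centraliser of a `5`-cycle in `S₅` is
the group it generates. [cite: DoudMoore2006, §2] -/
theorem dmLocal1951_decomposition_map_eq_zpowers (e₀ : absoluteGaloisGroup ℚ →* Equiv.Perm (Fin 5))
    (hker : IsOpen ((e₀.ker : Subgroup (absoluteGaloisGroup ℚ)) : Set (absoluteGaloisGroup ℚ))) :
    ∀ v : HeightOneSpectrum (𝓞 ℚ), v.residueCard = 1951 → ∀ 𝔓 ∈ v.primesAbove,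
      ∀ g : Equiv.Perm (Fin 5), orderOf g = 5 →
        (𝔓.inertia (absoluteGaloisGroup ℚ)).map e₀ = Subgroup.zpowers g →
          (𝔓.decompositionSubgroup (absoluteGaloisGroup ℚ)).map e₀ = Subgroup.zpowers g := by
  classical
  intro v hv
  -- `v` is the place above the prime `1951`
  have hp : Nat.Prime 1951 := by norm_num
  haveI : Fact (Nat.Prime 1951) := ⟨hp⟩
  have hpv : (Rat.HeightOneSpectrum.primesEquiv v : ℕ) = 1951 := by
    rw [← FramedRep.residueCard_eq_coe_primesEquiv' v]; exact hv
  -- local data at `F = ℚ_v`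
  set res := absGaloisRestrict ℚ (v.adicCompletion ℚ) with hres_def
  set lam : absoluteGaloisGroup (v.adicCompletion ℚ) →* Equiv.Perm (Fin 5) :=
    e₀.comp res.toMonoidHom with hlam_def
  have hlamopen : IsOpen ((lam.ker : Subgroup _) : Set (absoluteGaloisGroup (v.adicCompletion ℚ))) := by
    have : ((lam.ker : Subgroup _) : Set (absoluteGaloisGroup (v.adicCompletion ℚ))) =
        res ⁻¹' ((e₀.ker : Subgroup (absoluteGaloisGroup ℚ)) : Set (absoluteGaloisGroup ℚ)) := by
      ext σ; simp only [SetLike.mem_coe, MonoidHom.mem_ker, Set.mem_preimage, hlam_def,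
        MonoidHom.coe_comp, Function.comp_apply]; rfl
    rw [this]
    exact hker.preimage res.continuous
  have hq : 5 ∣ IsNonarchimedeanLocalField.residueFieldCard (v.adicCompletion ℚ) - 1 := by
    rw [residueFieldCard_adicCompletion_rat 1951 v hpv]; norm_num
  have hpd : ¬ ringChar (IsLocalRing.ResidueField
      (ValuativeRel.valuation (v.adicCompletion ℚ)).integer) ∣ 5 := by
    rw [ringChar_residueField_adicCompletion_rat 1951 v hpv]; norm_num
  -- the distinguished prime `𝔓₀` above `v`
  set 𝔓₀ := adicCompletionPrime ℚ v with h𝔓₀_def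
  have h𝔓₀v : 𝔓₀ ∈ v.primesAbove := adicCompletionPrime_mem_primesAbove ℚ v
  have key : ∀ g : Equiv.Perm (Fin 5), orderOf g = 5 →
      (𝔓₀.inertia (absoluteGaloisGroup ℚ)).map e₀ = Subgroup.zpowers g →
        (𝔓₀.decompositionSubgroup (absoluteGaloisGroup ℚ)).map e₀ = Subgroup.zpowers g := by
    intro g hg hI
    rw [h𝔓₀_def, map_inertia_adicCompletionPrime] at hI
    rw [h𝔓₀_def, map_decompositionSubgroup_adicCompletionPrime]
    exact range_eq_zpowers_of_map_absInertia_eq_zpowers lam hlamopen hI (by norm_num) hg hpd hq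
      (mem_zpowers_of_comm_of_orderOf_eq_five hg)
  -- any other prime above `v` is a conjugate of `𝔓₀`
  intro 𝔓 h𝔓 g hg hI
  obtain ⟨τ, rfl⟩ := HeightOneSpectrum.exists_smul_eq_of_mem_primesAbove_holds h𝔓₀v h𝔓
  rw [absIntegers.inertia_smul, map_conj_smul] at hI
  have hI₀ : (𝔓₀.inertia (absoluteGaloisGroup ℚ)).map e₀ =
      Subgroup.zpowers (MulAut.conj ((e₀ τ)⁻¹) g) := by
    rw [← conj_smul_zpowers, ← hI, smul_smul, ← map_mul, inv_mul_cancel, map_one, one_smul]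
  have hg' : orderOf (MulAut.conj ((e₀ τ)⁻¹) g) = 5 := by rw [MulEquiv.orderOf_eq]; exact hg
  have hD₀ := key _ hg' hI₀
  rw [Ideal.decompositionSubgroup_smul, map_conj_smul, hD₀, ← conj_smul_zpowers, smul_smul,
    ← map_mul, mul_inv_cancel, map_one, one_smul]

end Summit.Langlands.Langlands.Theorems.QuarterDeficit1951

end
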